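import Literature.MathematicalPhysics.QuantumFieldTheory.Balaban1983to89.Beta.RemainderStepAdapterHolo
import Literature.MathematicalPhysics.QuantumFieldTheory.Balaban1983to89.Beta.RemainderLocalitySockets

/-!
# [Balaban1987RG1] (1.7) p. 261 ∕ (1.21) p. 264 ∕ (4.4) p. 281 on the (4.4)-space MODEL: NODE E COMPLETE — the
# holomorphic-currency leaf list `PolLeavesTFac190H` of row (D4) INHABITED on the model carrier from object-level
# letters only (`Beta.RemainderDecay190SupNormLeaves`)

statement-level skeleton of published theorems with citation tags; proofs where landed; nothing here is a claim
about the Yang–Mills mass gap.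

HONEST FRAMING (cell rule).  Bookkeeping for the k-uniform remainder chain of row (D4) (`RemainderConst` ⇐ ONE
`ChainTFac190` instance, `Beta.RemainderDecay190`); discharges NOTHING of `BetaPertH`; NOT B12 Thm 2, NOT the continuum
limit, NOT Clay.  Unit `b2b-balaban-beta-an4` gen 95 (BINDER row D4 OWNER; cell pub-balaban).  Imports
`Beta.RemainderStepAdapterHolo` (the thin step object `StepObjectD4` and the socket `toPolLeavesTFac190H_ofActivities`)
and `Beta.RemainderLocalitySockets` (the (F2) engine `hconv_periodise₂_cubes`, gen 11) ONLY; nothing edited.  (Generation 94's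
`Beta.RemainderDecay190SupNormLimit.hconv_restrictCLM_of_periodised` is the NAMED form of the `hconv` step used in §3; it is
re-derived inside the proof from the gen-11 engine — five lines — so that this file depends on built modules only.)

WHAT.  Generations 93–94 FIXED the carriers of the (190)-socket `Data190` on the cube-torus block road — B-data and
configurations = real lattice fields on the fine torus `TPt d (N·M)`, (4.4)-space `Wn n := TPt d (N n·M) → ℂ` with the sup
norm read by restriction to the cubes of X̄ — and proved every carrier-side letter there (`hdom`, `hm`, `hD`, `hrow`,
`hdist`, `hκB`), leaving the Sect. G letters ON the subject `dHn` (`RemainderDecay190SupNorm.exists_data190_of_sectG_*`,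
an EXISTENCE with the (4.35) computation rule `hrule` exposed); and NODE E's test-vector limit `hconv` on that model with
the cell's (F2) instruments `V Y := ι Y → ℂ`, `r n Y := restrictCLM (N n·M) (e Y)` from an ENTRYWISE periodised-kernel
identity (`RemainderDecay190SupNormLimit.hconv_restrictCLM_of_periodised`).  THIS FILE closes NODE E and assembles the
LEAF LIST on the model:
* §1 `injective_proj_of_abs_sub_lt` ∕ `eventually_injective_proj` — finitely many distinct lattice sites have distinct
  residues on every torus with enough sites per direction ([I] (1.21) p. 264: *"T^{(j+1)} ↗ ℤ^d"*; elementary).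
* §2 `differentiableOn_window_of_fac` — THE (1.7)-FUNCTIONAL INHERITS HOLOMORPHY THROUGH THE WINDOW: if a functional
  `E` on the sup-normed torus fields is ℂ-differentiable on the α₂-ball and FACTORS there through the read-out at
  finitely many sites with distinct residues, `E v = F (restrictCLM T e v)`, then `F` is ℂ-differentiable on the α₂-ball
  of `ι → ℂ` — extension by zero is a right inverse of the read-out of sup norm ≤ 1 (`restrictCLM_extend`,
  `norm_extend_le`).  So the leaf `hFd` of `PolLeavesTFac190H` (*"F Y analytic at 0"*, [I] (1.7) p. 261 with [II]
  p. 15 *"E^{(k+1)}(X) … analytic functions of (𝐔, 𝐉)"*) is NOT an independent input on the model: it follows from the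
  H-layer holomorphy on ONE large torus and the factorization `hfac`.
* §3 **`nonempty_polLeavesTFac190H_supNorm`** — THE LEAF LIST ON THE MODEL: from a family of thin step objects `O n`
  over an exhausting torus sequence with Lemma 3 (2.38) on their activities (`h3`), a seam `emb n X` of the sup-normed
  complex fields into the analyticity domains (`hemb`) along which the ACTIVITIES are ℂ-differentiable (`hH`), ANY
  (190)-socket `D` over the model with the (4.35) rule (`hrule`) — e.g. generation 94's —, window sites `e Y` (finitely
  many distinct lattice sites inside the cubes of `Y`), window functionals `F Y` with the eventual factorization `hfac`
  ((1.7) + volume independence, in the `restrictCLM` currency), and ℤ^d kernels `S Y` jointly periodic, decaying, whose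
  periodisations give the window entries of the kernel of δ𝐇∕δB (`hker`) ⟹
  `Nonempty (PolLeavesTFac190H d M a c ℓ α₂ q)` with the READ-OUT `a Y z := Re ∂²(F Y)(0)[(S Y(e Y i, 0))_i, (S Y(e Y i, z))_i]`
  WRITTEN IN THE STATEMENT (`t Y x := (S Y (e Y i) x)_i`, `ha` by `rfl`, `hFd` by §2, `hconv` by the entrywise volume-limit
  engine exactly as in generation 94's `hconv_restrictCLM_of_periodised`).
  `nonempty_polLeavesTFac190H_supNorm_of_exists` takes the socket in generation 94's `∃ D, hrule` shape verbatim.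
* §4 **`remainderConst_of_stepObjects_supNorm`** — THE ROW-(D4) END FROM SUCH DATA PER (scale, history): with the
  (1.22) identification `beta1_eq` of `β¹_{k+1}(p)` against the written read-out and N1–N3,
  `RemainderConst S γ (ε₁ · K_rem,L(d, M, c, α₂, B₃(q)))` (`RemainderStepAdapterHolo.remainderConst_of_leafLists`).
AFTER THIS FILE, on the model carrier, EVERY field of `PolLeavesTFac190H` that is not an OBJECT (step objects `O n`,
seam `emb`, kernel family `dH n` ∕ socket `D`, window functionals `F Y`, kernels `S Y`) or an object-level LETTER (`h3`,
`hemb`, `hH`, the Sect. G letters behind `D`, `hfac`, `hS` ∕ `hdec` ∕ `hker`) is a DEFINITION or a THEOREM; the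
carriers `Wn`, `V`, `r`, `t`, `a` are no longer choices.  WHAT IS *NOT* DONE: no object of Bałaban's is constructed;
row D4 class UNCHANGED (instance 0∕1; critical-path width 0 = NODE O; D4 DISCHARGE NO DATE).  No `def`, no named fact,
no `sorry`, standard axioms.
HONEST DEPENDENCY: continuum YM on T⁴ ⇐ BetaPertH ∧ nine spine estimates (0/9 proved); BetaPertH ⇐ (D1) ∧ (D4) ∧
CAP+tail; G-an2-4 gates asym, D1 and NE2/3/4.

Sources: [I] = T. Bałaban, *Renormalization group approach to lattice gauge field theories. I*, Commun. Math. Phys.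
**109** (1987) 249–301 [Balaban1987RG1], (1.7) p. 261 (the localized representation of 𝐄^{(k+1)}), (1.21) p. 264
(*"T^{(j+1)} ↗ ℤ^d … This limit exists by the localized representation (1.7)"*), (1.22) p. 264, (4.4) p. 281, (4.35)
p. 290, (5.10) p. 293; [II] = T. Bałaban, *Renormalization group approach to lattice gauge field theories. II. Cluster
expansions*, Commun. Math. Phys. **116** (1988) 1–22 [Balaban1988RG2Cluster], p. 15, Lemma 3 (2.38) p. 20;
[15] = *The variational problem and background fields …*, Commun. Math. Phys. **102** (1985) 277–309
[Balaban1985Variational], (190) p. 308; T. Bałaban, *Propagators and renormalization transformations … I*, Commun.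
Math. Phys. **95** (1984) 17–40 [Balaban1984PropagatorsI], p. 36.
-/

namespace Literature.MathematicalPhysics.QuantumFieldTheory.Balaban1983to89.Beta.RemainderDecay190SupNormLeaves

open Literature.MathematicalPhysics.QuantumFieldTheory.Balaban1983to89
open Literature.MathematicalPhysics.QuantumFieldTheory.Balaban1983to89.B13ScaleTransfer (Pt)
open Literature.MathematicalPhysics.QuantumFieldTheory.Balaban1983to89.TreeLengthTorus (TPt TDom proj proj_apply)
open Literature.MathematicalPhysics.QuantumFieldTheory.Balaban1983to89.B12Decay510 (mixedDeriv)
open Literature.MathematicalPhysics.QuantumFieldTheory.Balaban1983to89.B12Decay510Lattice (cubeOf)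
open Literature.MathematicalPhysics.QuantumFieldTheory.Balaban1983to89.B12Decay510Torus (tcubeOf)
open Literature.MathematicalPhysics.QuantumFieldTheory.Balaban1983to89.Beta.RemainderLimitTorus (LDom tproj tproj_val limKernel)
open Literature.MathematicalPhysics.QuantumFieldTheory.Balaban1983to89.Beta.RemainderLocalityHolo (PolLeavesTFac190H)
open Literature.MathematicalPhysics.QuantumFieldTheory.Balaban1983to89.Beta.RemainderDecay190 (Data190 Consts190)
open Literature.MathematicalPhysics.QuantumFieldTheory.Balaban1983to89.Beta.RemainderChain (RemainderConst)
open Literature.MathematicalPhysics.QuantumFieldTheory.Balaban1983to89.Beta.RemainderChainLattice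
  (CondsL SignsL remCoeffL)
open Literature.MathematicalPhysics.QuantumFieldTheory.Balaban1983to89.Beta.RemainderStepAdapterHolo
  (StepObjectD4 toPolLeavesTFac190H_ofActivities remainderConst_of_leafLists)
open Literature.MathematicalPhysics.QuantumFieldTheory.Balaban1983to89.Beta (Kernel₂ IsPeriodic₂ Decay₂ periodise₂)
open Literature.MathematicalPhysics.QuantumFieldTheory.Balaban1983to89.Beta.RemainderLocalitySockets
  (restrictCLM restrictCLM_apply hconv_periodise₂_cubes)
open Literature.MathematicalPhysics.QuantumFieldTheory.Balaban1983to89.B12Decay510Torus (proj_cubeOf_of_proj_eq)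
open Metric Set Filter Topology

variable {d : ℕ}

/-! ## 1. Window sites on growing tori: eventually distinct residues -/

section Window

variable {ι : Type*}

/-- Distinct lattice sites whose coordinate differences are `< T` in absolute value have distinct residues on the
torus with `T` sites per direction (elementary). [cite: Balaban1987RG1, (1.21) p.264] -/
theorem injective_proj_of_abs_sub_lt (e : ι → Pt d) (he : Function.Injective e) {T : ℕ}
    (hT : ∀ i j k, |e i k - e j k| < T) : Function.Injective fun i => proj T (e i) := by
  intro i j hij
  apply he
  funext k
  have h1 : (e i k : ZMod T) = (e j k : ZMod T) := by
    dsimp only at hij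
    have h := congr_fun hij k
    simpa only [proj_apply] using h
  have h2 : (T : ℤ) ∣ e j k - e i k := (ZMod.intCast_eq_intCast_iff_dvd_sub _ _ _).mp h1
  have h3 : e j k - e i k = 0 := Int.eq_zero_of_abs_lt_dvd h2 (hT j i k)
  linarith

variable [Fintype ι]

/-- **Finitely many distinct lattice sites have distinct residues on every large torus**: if `T n → ∞` then
eventually `i ↦ [e i] mod T n` is injective ([I] (1.21): the tori exhaust ℤ^d). [cite: Balaban1987RG1, (1.21) p.264] -/
theorem eventually_injective_proj (e : ι → Pt d) (he : Function.Injective e) {T : ℕ → ℕ}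
    (hT : Tendsto T atTop atTop) : ∀ᶠ n in atTop, Function.Injective fun i => proj (T n) (e i) := by
  filter_upwards [hT.eventually_ge_atTop
    (Finset.univ.sup (fun p : ι × ι × Fin d => (e p.1 p.2.2 - e p.2.1 p.2.2).natAbs) + 1)] with n hn
  refine injective_proj_of_abs_sub_lt e he fun i j k => ?_
  have h1 : (e i k - e j k).natAbs ≤
      Finset.univ.sup (fun p : ι × ι × Fin d => (e p.1 p.2.2 - e p.2.1 p.2.2).natAbs) :=
    Finset.le_sup (f := fun p : ι × ι × Fin d => (e p.1 p.2.2 - e p.2.1 p.2.2).natAbs) (Finset.mem_univ (i, j, k))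
  rw [Int.abs_eq_natAbs]
  omega

end Window

/-! ## 2. The (1.7)-functional inherits holomorphy through the window -/

section Extend

variable {ι : Type*} [Fintype ι]

/-- Reading an extension by zero back at the window sites returns the window values, provided the residues of the
window sites are distinct (elementary). [cite: Balaban1987RG1, (1.7) p.261] -/
theorem restrictCLM_extend {T : ℕ} [NeZero T] (e : ι → Pt d) (hinj : Function.Injective fun i => proj T (e i)) (w : ι → ℂ) :
    restrictCLM T e (fun x' : TPt d T => ∑ i, if proj T (e i) = x' then w i else 0) = w := by
  funext j
  simp only [restrictCLM_apply]
  rw [Finset.sum_eq_single j]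
  · rw [if_pos rfl]
  · intro i _ hij
    exact if_neg fun h => hij (hinj h)
  · intro h
    exact absurd (Finset.mem_univ j) h

/-- The extension by zero has sup norm at most the window's (distinct residues: at most one window site per torus
site). [cite: Balaban1987RG1, (4.4) p.281] -/
theorem norm_extend_le {T : ℕ} [NeZero T] (e : ι → Pt d) (hinj : Function.Injective fun i => proj T (e i)) (w : ι → ℂ) :
    ‖(fun x' : TPt d T => ∑ i, if proj T (e i) = x' then w i else 0)‖ ≤ ‖w‖ := by
  refine (pi_norm_le_iff_of_nonneg (norm_nonneg w)).mpr fun x' => ?_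
  show ‖∑ i, (if proj T (e i) = x' then w i else 0)‖ ≤ ‖w‖
  by_cases hx : ∃ i, proj T (e i) = x'
  · obtain ⟨i₀, hi₀⟩ := hx
    rw [Finset.sum_eq_single i₀, if_pos hi₀]
    · exact norm_le_pi_norm w i₀
    · intro i _ hi
      exact if_neg fun h => hi (hinj (h.trans hi₀.symm))
    · intro h
      exact absurd (Finset.mem_univ i₀) h
  · rw [Finset.sum_eq_zero fun i _ => if_neg fun h => hx ⟨i, h⟩, norm_zero]
    exact norm_nonneg w

/-- **THE (1.7)-FUNCTIONAL INHERITS HOLOMORPHY THROUGH THE WINDOW.**  Let `E` be a functional on the sup-normed complex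
fields of the torus with `T` sites per direction, ℂ-differentiable on the α₂-ball ([II] p. 15: *"E^{(k+1)}(X) … analytic
functions of (𝐔, 𝐉)"*, read along the (4.4)-seam of [I] p. 281), which FACTORS on that ball through the read-out at
finitely many lattice sites `e i` with distinct residues: `E v = F (restrictCLM T e v)` ([I] (1.7) p. 261: the
localized functional depends on the configuration in the window only).  Then `F` is ℂ-differentiable on the α₂-ball of
`ι → ℂ`: `F = E ∘ ext` there, `ext` = extension by zero (a continuous linear right inverse of the read-out of norm ≤ 1).
[cite: Balaban1987RG1, (1.7) p.261, (4.4) p.281; Balaban1988RG2Cluster, p.15] -/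
theorem differentiableOn_window_of_fac {T : ℕ} [NeZero T] {E : (TPt d T → ℂ) → ℂ} {α₂ : ℝ}
    (hE : DifferentiableOn ℂ E (ball 0 α₂)) (e : ι → Pt d) (hinj : Function.Injective fun i => proj T (e i))
    {F : (ι → ℂ) → ℂ} (hfac : ∀ v ∈ ball (0 : TPt d T → ℂ) α₂, E v = F (restrictCLM T e v)) :
    DifferentiableOn ℂ F (ball 0 α₂) := by
  -- extension by zero as a linear map on the finite-dimensional window space, made continuous
  let extL : (ι → ℂ) →ₗ[ℂ] (TPt d T → ℂ) :=
    { toFun := fun w x' => ∑ i, if proj T (e i) = x' then w i else 0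
      map_add' := fun w₁ w₂ => by
        funext x'
        simp only [Pi.add_apply]
        rw [← Finset.sum_add_distrib]
        refine Finset.sum_congr rfl fun i _ => ?_
        split_ifs <;> simp
      map_smul' := fun s w => by
        funext x'
        simp only [Pi.smul_apply, smul_eq_mul, RingHom.id_apply]
        rw [Finset.mul_sum]
        refine Finset.sum_congr rfl fun i _ => ?_
        split_ifs <;> simp }
  let ext : (ι → ℂ) →L[ℂ] (TPt d T → ℂ) := LinearMap.toContinuousLinearMap extL
  have hext : ∀ w, ext w = fun x' => ∑ i, if proj T (e i) = x' then w i else 0 := fun _ => rfl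
  have hmaps : MapsTo ext (ball (0 : ι → ℂ) α₂) (ball 0 α₂) := fun w hw => by
    rw [mem_ball_zero_iff] at hw ⊢
    rw [hext]
    exact (norm_extend_le e hinj w).trans_lt hw
  refine (hE.comp ext.differentiableOn hmaps).congr fun w hw => ?_
  show F w = E (ext w)
  rw [hfac (ext w) (hmaps hw), hext, restrictCLM_extend e hinj]

end Extend

/-! ## 3. THE LEAF LIST ON THE MODEL CARRIER -/

section Leaves

variable {M : ℕ} [NeZero M]

/-- **NODE E COMPLETE — `PolLeavesTFac190H` INHABITED ON THE (4.4)-SPACE MODEL FROM OBJECT-LEVEL LETTERS ONLY.**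
Carriers FIXED: `Wn n := TPt d (N n·M) → ℂ` (sup norm), `V Y := ι Y → ℂ`, `r n Y := restrictCLM (N n·M) (e Y)`,
`t Y x := (S Y (e Y i) x)_i`, and the read-out `a Y z := Re ∂²(F Y)(0)[t Y 0, t Y z]` WRITTEN IN THE CONCLUSION.  Inputs
(all object-level): an exhausting torus sequence (`hNlim`); thin step objects `O n` with Lemma 3 (2.38) on their
activities (`h3`), `CondsL`, `0 ≤ C₃ε₁`, `0 < α₂`; a seam `emb n X` into the analyticity domains (`hemb`) along which the
activities are ℂ-differentiable (`hH`, [II] p. 15); a (190)-socket `D` over the model whose (4.35) test vector is the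
restricted kernel column of `dH n` (`hrule`, generation 94's computation rule); window sites `e Y` — finitely many
DISTINCT lattice sites inside the cubes of `Y` (`he`, `hinj`); window functionals `F Y` with the eventual factorization
`hfac` ([I] (1.7) + independence of the volume); ℤ^d kernels `S Y` jointly `N n·M`-periodic (`hS`), decaying (`hdec`,
`δ > 0`), whose periodisations give the window entries of the kernel of `dH n` (`hker`, [I] (5.10) shape).  Output:
`Nonempty (PolLeavesTFac190H d M a c ℓ α₂ q)` — `hFd` by §2 on one large torus, `hconv` by the engine
`RemainderLocalitySockets.hconv_periodise₂_cubes` read through `hrule` ∕ `hker` (the argument of generation 94's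
`RemainderDecay190SupNormLimit.hconv_restrictCLM_of_periodised`, its named form), `ha` by `rfl`.  Nothing of Bałaban's is
constructed.
[cite: Balaban1987RG1, (1.7) p.261, (1.21) p.264, (4.4) p.281, (4.35) p.290, (5.10) p.293; Balaban1988RG2Cluster, p.15 and (2.38) p.20; Balaban1985Variational, (190) p.308] -/
theorem nonempty_polLeavesTFac190H_supNorm (N : ℕ → ℕ) [hN : ∀ n, NeZero (N n)] (hNlim : Tendsto N atTop atTop)
    (O : (n : ℕ) → StepObjectD4 d (N n)) (c : B13.Consts) (ℓ α₂ : ℝ) (q : Consts190)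
    (h3 : ∀ n, (O n).Lemma3OnH c ℓ) (hC : CondsL d c ℓ) (hA : 0 ≤ c.C3act * c.ε₁) (hα₂ : 0 < α₂)
    (emb : (n : ℕ) → TDom d (N n) → (TPt d (N n * M) → ℂ) → (O n).Φ)
    (hemb : ∀ n X, ∀ v ∈ ball (0 : TPt d (N n * M) → ℂ) α₂, emb n X v ∈ (O n).sp2 X)
    (hH : ∀ n (X Z : TDom d (N n)), Z.1 ⊆ X.1 →
      DifferentiableOn ℂ (fun v => (O n).H Z (emb n X v)) (ball 0 α₂))
    (D : Data190 d M N (fun n => TPt d (N n * M) → ℂ) q)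
    (dH : (n : ℕ) → (TPt d (N n * M) → ℝ) →ₗ[ℝ] (TPt d (N n * M) → ℝ))
    (hrule : ∀ (n : ℕ) (X : TDom d (N n)) (x : TPt d (N n * M)),
      D.hn n X x = fun x' : TPt d (N n * M) =>
        if tcubeOf (N n) M x' ∈ X.1 then ((dH n (Pi.single x (1 : ℝ)) x' : ℝ) : ℂ) else 0)
    {ι : LDom d → Type} [∀ Y, Fintype (ι Y)] (e : (Y : LDom d) → ι Y → Pt d)
    (he : ∀ Y i, cubeOf M (e Y i) ∈ Y.1) (hinj : ∀ Y, Function.Injective (e Y))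
    (F : (Y : LDom d) → (ι Y → ℂ) → ℂ)
    (hfac : ∀ Y : LDom d, ∀ᶠ n in atTop, ∀ v ∈ ball (0 : TPt d (N n * M) → ℂ) α₂,
      (O n).E (tproj (N n) Y) (emb n (tproj (N n) Y) v) = F Y (restrictCLM (N n * M) (e Y) v))
    {S : LDom d → Kernel₂ d} {C δ : ℝ}
    (hS : ∀ Y n, IsPeriodic₂ (N n * M) (S Y)) (hdec : ∀ Y, Decay₂ (S Y) C δ) (hδ : 0 < δ)
    (hker : ∀ (Y : LDom d) (n : ℕ) (i : ι Y) (x : Pt d),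
      dH n (Pi.single (proj (N n * M) x) (1 : ℝ)) (proj (N n * M) (e Y i)) =
        periodise₂ (N n * M) (S Y) (proj (N n * M) (e Y i)) (proj (N n * M) x)) :
    Nonempty (PolLeavesTFac190H d M
      (fun Y z => (mixedDeriv (F Y) (fun i => (S Y (e Y i) 0 : ℂ)) (fun i => (S Y (e Y i) z : ℂ))).re) c ℓ α₂ q) := by
  have hT : Tendsto (fun n => N n * M) atTop atTop :=
    tendsto_atTop_mono (fun n => Nat.le_mul_of_pos_right (N n) (Nat.pos_of_neZero M)) hNlim
  have hFd : ∀ Y : LDom d, ∃ ρ > 0, DifferentiableOn ℂ (F Y) (ball 0 ρ) := fun Y => by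
    obtain ⟨n, hn, hinjn⟩ := ((hfac Y).and (eventually_injective_proj (e Y) (hinj Y) hT)).exists
    exact ⟨α₂, hα₂, differentiableOn_window_of_fac
      ((O n).differentiableOn_E_of_activities (h3 n) hC hA (tproj (N n) Y) (emb n (tproj (N n) Y))
        (hemb n (tproj (N n) Y)) (hH n (tproj (N n) Y)))
      (e Y) hinjn hn⟩
  -- the cube of the residue of a window site is a cube of `tproj Y` (the site lies in a cube of `Y`)
  have hmem : ∀ (Y : LDom d) (n : ℕ) (i : ι Y), tcubeOf (N n) M (proj (N n * M) (e Y i)) ∈ (tproj (N n) Y).1 :=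
    fun Y n i => by
      rw [tproj_val, ← proj_cubeOf_of_proj_eq (N := N n) (M := M) (P := e Y i) rfl]
      exact Finset.mem_image_of_mem _ (he Y i)
  -- (1.21) on the model: the restricted test vectors are restricted periodised columns, which converge entrywise
  have hconv : ∀ (Y : LDom d) (x : Pt d),
      Tendsto (fun n => restrictCLM (N n * M) (e Y) (D.hn n (tproj (N n) Y) (proj (N n * M) x))) atTop
        (𝓝 fun i => (S Y (e Y i) x : ℂ)) := fun Y x => by
    refine (hconv_periodise₂_cubes (hS Y) (hdec Y) hδ hNlim (e Y) x).congr fun n => ?_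
    funext i
    simp only [restrictCLM_apply, hrule]
    rw [if_pos (hmem Y n i), hker]
  exact ⟨toPolLeavesTFac190H_ofActivities N hNlim O c ℓ α₂ q h3 hC hA (fun n => TPt d (N n * M) → ℂ) emb hemb hH
    D (fun Y => ι Y → ℂ) F hFd (fun n Y => restrictCLM (N n * M) (e Y)) hfac
    (fun Y x => fun i => (S Y (e Y i) x : ℂ)) hconv _ fun _ _ => rfl⟩

/-- **The same with the (190)-socket given in generation 94's EXISTENCE shape** `∃ D, hrule` — the conclusion of
`RemainderDecay190SupNorm.exists_data190_of_sectG_blocks_supNorm` ∕ `_cubes_supNorm` verbatim — so that the per-torus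
Sect. G letters of [15] feed the leaf list by ONE application. [cite: Balaban1985Variational, (182)-(190) pp.307-308; Balaban1987RG1, (1.7) p.261, (1.21) p.264, (4.4) p.281] -/
theorem nonempty_polLeavesTFac190H_supNorm_of_exists (N : ℕ → ℕ) [hN : ∀ n, NeZero (N n)]
    (hNlim : Tendsto N atTop atTop)
    (O : (n : ℕ) → StepObjectD4 d (N n)) (c : B13.Consts) (ℓ α₂ : ℝ) (q : Consts190)
    (h3 : ∀ n, (O n).Lemma3OnH c ℓ) (hC : CondsL d c ℓ) (hA : 0 ≤ c.C3act * c.ε₁) (hα₂ : 0 < α₂)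
    (emb : (n : ℕ) → TDom d (N n) → (TPt d (N n * M) → ℂ) → (O n).Φ)
    (hemb : ∀ n X, ∀ v ∈ ball (0 : TPt d (N n * M) → ℂ) α₂, emb n X v ∈ (O n).sp2 X)
    (hH : ∀ n (X Z : TDom d (N n)), Z.1 ⊆ X.1 →
      DifferentiableOn ℂ (fun v => (O n).H Z (emb n X v)) (ball 0 α₂))
    (dH : (n : ℕ) → (TPt d (N n * M) → ℝ) →ₗ[ℝ] (TPt d (N n * M) → ℝ))
    (hD : ∃ D : Data190 d M N (fun n => TPt d (N n * M) → ℂ) q,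
      ∀ (n : ℕ) (X : TDom d (N n)) (x : TPt d (N n * M)),
        D.hn n X x = fun x' : TPt d (N n * M) =>
          if tcubeOf (N n) M x' ∈ X.1 then ((dH n (Pi.single x (1 : ℝ)) x' : ℝ) : ℂ) else 0)
    {ι : LDom d → Type} [∀ Y, Fintype (ι Y)] (e : (Y : LDom d) → ι Y → Pt d)
    (he : ∀ Y i, cubeOf M (e Y i) ∈ Y.1) (hinj : ∀ Y, Function.Injective (e Y))
    (F : (Y : LDom d) → (ι Y → ℂ) → ℂ)
    (hfac : ∀ Y : LDom d, ∀ᶠ n in atTop, ∀ v ∈ ball (0 : TPt d (N n * M) → ℂ) α₂,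
      (O n).E (tproj (N n) Y) (emb n (tproj (N n) Y) v) = F Y (restrictCLM (N n * M) (e Y) v))
    {S : LDom d → Kernel₂ d} {C δ : ℝ}
    (hS : ∀ Y n, IsPeriodic₂ (N n * M) (S Y)) (hdec : ∀ Y, Decay₂ (S Y) C δ) (hδ : 0 < δ)
    (hker : ∀ (Y : LDom d) (n : ℕ) (i : ι Y) (x : Pt d),
      dH n (Pi.single (proj (N n * M) x) (1 : ℝ)) (proj (N n * M) (e Y i)) =
        periodise₂ (N n * M) (S Y) (proj (N n * M) (e Y i)) (proj (N n * M) x)) :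
    Nonempty (PolLeavesTFac190H d M
      (fun Y z => (mixedDeriv (F Y) (fun i => (S Y (e Y i) 0 : ℂ)) (fun i => (S Y (e Y i) z : ℂ))).re) c ℓ α₂ q) := by
  obtain ⟨D, hrule⟩ := hD
  exact nonempty_polLeavesTFac190H_supNorm N hNlim O c ℓ α₂ q h3 hC hA hα₂ emb hemb hH D dH hrule e he hinj F hfac
    hS hdec hδ hker

end Leaves

/-! ## 4. The row-(D4) END from such data per (scale, history) -/

section End

variable {M : ℕ} [NeZero M]

/-- **HOW (D4) CLOSES ON THE MODEL CARRIER, in one statement.**  For the β-family `β` with one-loop split `S` on the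
boxes `]0,γ]^{k+1}`: IF for every scale `k` and history `p` the object-level data of `nonempty_polLeavesTFac190H_supNorm`
are given (torus sequence, thin step objects with (2.38), seam + H-layer holomorphy, a (190)-socket on the model in the
`∃ D, hrule` shape, window sites ∕ functionals with (1.7)-factorization, periodised ℤ^d kernels with the entrywise
identity) AND `β¹_{k+1}(p)` is the second moment of the limit kernel of the WRITTEN read-out ((1.22), `beta1_eq`), THEN
`|β¹_{k+1}(g_0,…,g_k)| ≤ ε₁ · K_rem,L(d, M, c, α₂, B₃(q))` on every box (`RemainderConst`), under N1–N3 (`0 ≤ C₃ε₁` and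
`0 < α₂` are read off the sign record `hs`).  The carriers
are not arguments any more.  Nothing of Bałaban's is asserted.
[cite: Balaban1987RG1, (1.22) p.264, (1.7) p.261, (4.4) p.281 and (5.10) p.293; Balaban1988RG2Cluster, p.15 and (2.38) p.20; Balaban1985Variational, (190) p.308] -/
theorem remainderConst_of_stepObjects_supNorm {μ ν : Fin d} {β : FlowStep.HBeta} (S : B12Beta.OneLoopSplit β)
    {γ : ℝ} {c : B13.Consts} {ℓ α₂ : ℝ} {q : Consts190}
    (hC : CondsL d c ℓ) (h22 : c.R22gen ℓ) (hq : q.Valid c.δ₀) (hs : SignsL c α₂ q.B₃)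
    -- per (scale, history): the torus family, the step objects, (2.38), the seam, the H-layer datum
    (N : (k : ℕ) → (Fin (k + 1) → ℝ) → ℕ → ℕ) (hN : ∀ k p n, NeZero (N k p n))
    (hNlim : ∀ k p, Tendsto (N k p) atTop atTop)
    (O : (k : ℕ) → (p : Fin (k + 1) → ℝ) → (n : ℕ) → StepObjectD4 d (N k p n))
    (h3 : ∀ k p n, (O k p n).Lemma3OnH c ℓ)
    (emb : (k : ℕ) → (p : Fin (k + 1) → ℝ) → (n : ℕ) → TDom d (N k p n) →
      (TPt d (N k p n * M) → ℂ) → (O k p n).Φ)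
    (hemb : ∀ k p n X, ∀ v ∈ ball (0 : TPt d (N k p n * M) → ℂ) α₂, emb k p n X v ∈ (O k p n).sp2 X)
    (hH : ∀ k p n (X Z : TDom d (N k p n)), Z.1 ⊆ X.1 →
      DifferentiableOn ℂ (fun v => (O k p n).H Z (emb k p n X v)) (ball 0 α₂))
    -- per (scale, history): the kernel family of δ𝐇∕δB and a (190)-socket on the model with the (4.35) rule
    (dH : (k : ℕ) → (p : Fin (k + 1) → ℝ) → (n : ℕ) →
      (TPt d (N k p n * M) → ℝ) →ₗ[ℝ] (TPt d (N k p n * M) → ℝ))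
    (hD : ∀ k p, ∃ D : Data190 d M (N k p) (fun n => TPt d (N k p n * M) → ℂ) q,
      ∀ (n : ℕ) (X : TDom d (N k p n)) (x : TPt d (N k p n * M)),
        D.hn n X x = fun x' : TPt d (N k p n * M) =>
          if tcubeOf (N k p n) M x' ∈ X.1 then ((dH k p n (Pi.single x (1 : ℝ)) x' : ℝ) : ℂ) else 0)
    -- the window: sites, functionals, (1.7)-factorization; the ℤ^d kernels and the entrywise identity
    {ι : LDom d → Type} [∀ Y, Fintype (ι Y)] (e : (Y : LDom d) → ι Y → Pt d)
    (he : ∀ Y i, cubeOf M (e Y i) ∈ Y.1) (hinj : ∀ Y, Function.Injective (e Y))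
    (F : (k : ℕ) → (p : Fin (k + 1) → ℝ) → (Y : LDom d) → (ι Y → ℂ) → ℂ)
    (hfac : ∀ k p (Y : LDom d), ∀ᶠ n in atTop, ∀ v ∈ ball (0 : TPt d (N k p n * M) → ℂ) α₂,
      (O k p n).E (tproj (N k p n) Y) (emb k p n (tproj (N k p n) Y) v) =
        F k p Y (restrictCLM (N k p n * M) (e Y) v))
    (Sk : (k : ℕ) → (Fin (k + 1) → ℝ) → LDom d → Kernel₂ d) (C δ : (k : ℕ) → (Fin (k + 1) → ℝ) → ℝ)
    (hS : ∀ k p Y n, IsPeriodic₂ (N k p n * M) (Sk k p Y)) (hdec : ∀ k p Y, Decay₂ (Sk k p Y) (C k p) (δ k p))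
    (hδ : ∀ k p, 0 < δ k p)
    (hker : ∀ k p (Y : LDom d) (n : ℕ) (i : ι Y) (x : Pt d),
      dH k p n (Pi.single (proj (N k p n * M) x) (1 : ℝ)) (proj (N k p n * M) (e Y i)) =
        periodise₂ (N k p n * M) (Sk k p Y) (proj (N k p n * M) (e Y i)) (proj (N k p n * M) x))
    -- the (1.22) identification against the WRITTEN read-out
    (beta1_eq : ∀ k p, p ∈ B12Beta.HistBox γ k →
      S.β1 k p = B12Beta.secondMoment (fun _ _ => limKernel fun Y z =>
        (mixedDeriv (F k p Y) (fun i => (Sk k p Y (e Y i) 0 : ℂ)) (fun i => (Sk k p Y (e Y i) z : ℂ))).re) μ ν) :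
    RemainderConst S γ (c.ε₁ * remCoeffL d M c α₂ q.B₃) :=
  remainderConst_of_leafLists S
    (fun k p Y z => (mixedDeriv (F k p Y) (fun i => (Sk k p Y (e Y i) 0 : ℂ)) (fun i => (Sk k p Y (e Y i) z : ℂ))).re)
    beta1_eq
    (fun k p _ => (nonempty_polLeavesTFac190H_supNorm_of_exists (hN := hN k p) (N k p) (hNlim k p) (O k p) c ℓ α₂ q
      (h3 k p) hC hs.A hs.α₂_pos (emb k p) (hemb k p) (hH k p) (dH k p) (hD k p) e he hinj (F k p) (hfac k p)
      (hS k p) (hdec k p) (hδ k p) (hker k p)).some)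
    hC h22 hq hs

end End

end Literature.MathematicalPhysics.QuantumFieldTheory.Balaban1983to89.Beta.RemainderDecay190SupNormLeaves
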